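import Summits.ResolutionOfSingularities.ResolutionOfSingularities.Theorems.FrobeniusClosingPatchingRelPerfectDepthMultiHostEnd
import Summits.ResolutionOfSingularities.ResolutionOfSingularities.Theorems.FrobeniusClosingPatchingRelPerfectDepthMixedFormatBTraces
import Literature.AlgebraicGeometry.Resolution.BlowupRestrictOpen
import Literature.AlgebraicGeometry.Resolution.NormalCrossingsLocal
import HarnessLib

/-!
# Crux `PatchingRelPerfect` (stmt-ResolutionOfSingularities-16161), chain W5.2 — F7(β) d = 2 (β-AX) A1 «END CURRENCY»:
# the FORMAT-SNC END `IsFormatSncOn`, bridge E1 to `IsEndOn` / T7β-M, and E2 (format-snc END is kept by a `step` whose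
# centre meets the open in a stratum of the END family)

[OURS · L1 W5.2 · F7(β) (β-AX) X-side · res-L1-w52-plan-1 RULING G11-10 (2026-08-27T15:38:33Z) «NEW NAMED PREDICATE
`MultiHostState.IsFormatSncOn` … host FACTORISATION into global prime-divisor ideals on U … + BRIDGE E1 `isEndOn_of_isFormatSncOn`
… + E2 `IsFormatSncOn` is preserved on U under the blow-up of (a component of) a STRATUM of the U-family with the exceptional
appended», NOTE G11-10 (2′) «every list on the same 𝓕 in the same order», ASSEMBLY SPEC v4.1 (9d96b39146a41fd3) §6 A1.]  Replaces the
role of NO printed item; NOT a statement of the manuscript under review; fact-free.  AI-written; AI review is weaker than expert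
review.  OURS definition `IsFormatSncOn` (statement-lane rules: no instances, no notation).

## Contents (namespace `…Theorems.DepthMultiHost`)
* `MultiHostState.IsFormatSncOn S U 𝓒 𝓗` — the STRONG (format-snc) END of a multi-host state on the open `U`: GLOBAL component
  ideals `𝓒` and, for every summand `i`, a host exponent list `𝓗 i` ON THE COMMON FAMILY `𝓒 ++ S.𝓔` (same members, same order
  — the `boundaryOf_exps` convention of `MultiHostState`; components FIRST so that a `step` appends its exceptional member at the
  END, cf. `step_𝓔`), such that ON `U` the family `𝓒 ++ S.𝓔` has simple normal crossings and every host factors: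
  `(host i)|_U = (monomialIdeal (𝓗 i))|_U`.  No cosupport clause.  `isFormatSncOn_ofFun` — the exponent-FUNCTION form of
  NOTE G11-10 (2′) as a constructor; `IsFormatSncOn.mono` — shrinking `U`.
* **E1** `MultiHostState.isEndOn_of_isFormatSncOn` — `cosupp K ⊆ U` and format-snc END on `U` ⇒ `IsEndOn S U` (p543632) with
  `𝓕 := (𝓒 ++ S.𝓔) ++ S.𝓔` and one list `𝓗 i ++ S.exps i` per summand (`K|_U = (monomialSum 𝒦)|_U` summand by summand:
  `comap` along `U.ι` commutes with `*` and `⨆`); `IsFormatSncOn.exists_centreSeq` — hence T4 (principalization by regular centres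
  over `cosupp K`, regular top).  Needs `S.n ≠ 0` (for `n = 0`, `K = ⊥` is no monomial sum).
* **E2** `MultiHostState.IsFormatSncOn.step` — along a `step` (p540590) at an irreducible centre `W` whose generic point lies in
  `U` and whose trace `𝓘_W|_U` is a STRATUM `T.sup id` of the `U`-family, with host orders `m i ≤ weightAt (𝓗 i) η`, the successor
  state is format-snc END on `τ⁻¹ U` with components `𝓒.map st` and host lists `(𝓗 i).map (st × id) ++ [(F, weightAt (𝓗 i) η − m i)]`
  — proved ON THE SCHEME `U` by the (T1) irreducible-centre law of p543632 and Kollár's Def. 3.25 (`hasSNC_transform`), read back on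
  `X′` with the restriction kit `Literature/…/BlowupRestrictOpen` (`controlledTransform_/strictTransformIdeal_/transformBoundary_
  morphismRestrict`: the open immersion `τ⁻¹U ↪ X′` is flat).  No unique factorisation anywhere: factorisations are transported.
* helpers: `monomialSum_ofFn`, `weightAt_map_comap`, `isGenericPoint_preimage_ι` (snc depends on the member SET only:
  `DepthGraded.Trace.hasSNCWith_of_subset`, p-landed, reused).

## References
* E. Bierstone, D. Grigoriev, P. Milman, J. Włodarczyk, *Effective Hironaka resolution and its complexity*, Asian J. Math. 15 (2011),
  Def. 3.1.1, Def. 3.1.3, Lemma 3.2.1, §4 Step 2b, Thm. 8.0.5. [BierstoneGrigorievMilmanWlodarczyk2011]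
* J. Kollár, *Lectures on Resolution of Singularities* (2007), (3.111) Steps 1–3, Def. 3.25. [Kollar2007]
* U. Görtz, T. Wedhorn, *Algebraic Geometry I* (2nd ed., 2020), Prop. 13.91. [GortzWedhorn2020]
-/

-- `Summit.<Summit>.<Sub>.Theorems` with `Sub = Summit` (single-conjunct summit, D-0017)
set_option linter.dupNamespace false

noncomputable section

open CategoryTheory AlgebraicGeometry TopologicalSpace
open Literature.AlgebraicGeometry.Resolution
open Literature.AlgebraicGeometry.Hironaka2017.MonomialPart
open Scheme.IdealSheafData

namespace Summit.ResolutionOfSingularities.ResolutionOfSingularities.Theorems.DepthMultiHost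

universe u

variable {X X' : Scheme.{u}}

/-! ## §0 Helpers -/

/-- A summand of a monomial sum is contained in it. [folklore] -/
theorem monomialIdeal_le_monomialSum {𝒦 : List (List (X.IdealSheafData × ℕ))} {A : List (X.IdealSheafData × ℕ)}
    (h : A ∈ 𝒦) : monomialIdeal A ≤ DepthTargets.monomialSum 𝒦 := by
  induction 𝒦 with
  | nil => simp at h
  | cons B 𝒦 ih =>
    rw [DepthTargets.monomialSum_cons]
    rcases List.mem_cons.mp h with rfl | h
    · exact le_sup_left
    · exact (ih h).trans le_sup_right

/-- A monomial sum is below an ideal iff every summand is. [folklore] -/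
theorem monomialSum_le_iff {𝒦 : List (List (X.IdealSheafData × ℕ))} {J : X.IdealSheafData} :
    DepthTargets.monomialSum 𝒦 ≤ J ↔ ∀ A ∈ 𝒦, monomialIdeal A ≤ J := by
  induction 𝒦 with
  | nil => simp
  | cons B 𝒦 ih => rw [DepthTargets.monomialSum_cons, sup_le_iff, ih, List.forall_mem_cons]

/-- **A monomial sum indexed by `Fin n` is the supremum of its summands.** [folklore] -/
theorem monomialSum_ofFn {n : ℕ} (L : Fin n → List (X.IdealSheafData × ℕ)) :
    DepthTargets.monomialSum (List.ofFn L) = ⨆ i, monomialIdeal (L i) :=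
  le_antisymm
    (monomialSum_le_iff.mpr fun A hA => by
      obtain ⟨i, rfl⟩ := List.mem_ofFn.mp hA
      exact le_iSup (fun i => monomialIdeal (L i)) i)
    (iSup_le fun i => monomialIdeal_le_monomialSum (List.mem_ofFn.mpr ⟨i, rfl⟩))

/-- The weight of a pulled-back exponent list at a point is the weight at its image. [folklore] -/
theorem weightAt_map_comap (L : List (X.IdealSheafData × ℕ)) (f : X' ⟶ X) (x' : X') :
    weightAt (L.map fun p => (p.1.comap f, p.2)) x' = weightAt L (f x') := by
  induction L with
  | nil => simp
  | cons p L ih =>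
    have h : x' ∈ (p.1.comap f).support ↔ f x' ∈ p.1.support := by
      rw [Scheme.IdealSheafData.support_comap]
      rfl
    rw [List.map_cons, weightAt_cons, weightAt_cons, ih]
    by_cases hx : f x' ∈ p.1.support
    · rw [if_pos hx, if_pos (h.mpr hx)]
    · rw [if_neg hx, if_neg (fun h' => hx (h.mp h'))]

/-- **The generic point of an irreducible closed set lying in an open `U` is the generic point of its trace on `U`.** [folklore] -/
theorem isGenericPoint_preimage_ι {W : Closeds X} {η : X} (hη : IsGenericPoint η (W : Set X)) (U : X.Opens) (y : U)
    (hy : U.ι y = η) : IsGenericPoint y ((W.preimage U.ι.continuous : Closeds U) : Set U) := by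
  have h1 : (U.ι : U → X) ⁻¹' ({η} : Set X) = ({y} : Set U) := by
    ext z
    simp only [Set.mem_preimage, Set.mem_singleton_iff]
    constructor
    · intro hz
      exact U.ι.isOpenEmbedding.injective (hz.trans hy.symm)
    · rintro rfl
      exact hy
  have hW : closure ({η} : Set X) = (W : Set X) := hη
  change closure ({y} : Set U) = (U.ι : U → X) ⁻¹' (W : Set X)
  rw [← h1, ← U.ι.isOpenEmbedding.isOpenMap.preimage_closure_eq_closure_preimage U.ι.continuous, hW]

namespace MultiHostState

/-! ## §1 The format-snc END -/

/-- [OURS · L1 W5.2 · F7(β) A1] **FORMAT-SNC END of the multi-host state `S` on the open `U`**: global COMPONENT ideals `𝓒`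
and, for every summand `i`, a host exponent list `𝓗 i` on the common family `𝓒 ++ S.𝓔` (components first, then the members; same
members in the same order for all `i`), such that ON `U` the family `𝓒 ++ S.𝓔` has simple normal crossings and every host
FACTORS: `(host i)|_U = (Π_{F} 𝓘_F^{𝓗 i F})|_U`.  Then `K = Σ_i host i · x^{exps i}` is, on `U`, a sum of monomials in ONE snc
family — the STRONG END; `IsEndOn` (p543632) is the weak one (E1 `isEndOn_of_isFormatSncOn`).  A host `⊤` takes all exponents
`0`. [cite: BierstoneGrigorievMilmanWlodarczyk2011, Def. 3.1.1 and Def. 3.1.3] [cite: Kollar2007, (3.111) Step 3] -/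
def IsFormatSncOn (S : MultiHostState X) (U : X.Opens) (𝓒 : List X.IdealSheafData)
    (𝓗 : Fin S.n → List (X.IdealSheafData × ℕ)) : Prop :=
  (∀ i, boundaryOf (𝓗 i) = 𝓒 ++ S.𝓔) ∧ HasSNC ((𝓒 ++ S.𝓔).map fun F => F.comap U.ι) ∧
    ∀ i, (S.host i).comap U.ι = (monomialIdeal (𝓗 i)).comap U.ι

namespace IsFormatSncOn

variable {S : MultiHostState X} {U : X.Opens} {𝓒 : List X.IdealSheafData} {𝓗 : Fin S.n → List (X.IdealSheafData × ℕ)}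

/-- The host lists live on the common family `𝓒 ++ S.𝓔`. [folklore] -/
theorem boundaryOf_eq (h : S.IsFormatSncOn U 𝓒 𝓗) (i : Fin S.n) : boundaryOf (𝓗 i) = 𝓒 ++ S.𝓔 :=
  h.1 i

/-- The family `𝓒 ++ S.𝓔` has simple normal crossings on `U`. [folklore] -/
theorem hasSNC (h : S.IsFormatSncOn U 𝓒 𝓗) : HasSNC ((𝓒 ++ S.𝓔).map fun F => F.comap U.ι) :=
  h.2.1

/-- The host factorisation on `U`. [folklore] -/
theorem host_eq (h : S.IsFormatSncOn U 𝓒 𝓗) (i : Fin S.n) : (S.host i).comap U.ι = (monomialIdeal (𝓗 i)).comap U.ι :=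
  h.2.2 i

/-- **Each summand is a monomial on `U`**: `(host i · x^{exps i})|_U = (x^{𝓗 i ++ exps i})|_U`. [cite: Kollar2007, (3.111) Step 3] -/
theorem comap_summand (h : S.IsFormatSncOn U 𝓒 𝓗) (i : Fin S.n) :
    (S.host i * monomialIdeal (S.exps i)).comap U.ι = (monomialIdeal (𝓗 i ++ S.exps i)).comap U.ι := by
  rw [comap_mul, h.host_eq i, monomialIdeal_append, comap_mul]

/-- **`K` is a monomial sum on `U`**: `K|_U = (Σ_i x^{𝓗 i ++ exps i})|_U`. [cite: Kollar2007, (3.111) Step 3] -/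
theorem comap_K (h : S.IsFormatSncOn U 𝓒 𝓗) :
    S.K.comap U.ι = (DepthTargets.monomialSum (List.ofFn fun i => 𝓗 i ++ S.exps i)).comap U.ι := by
  rw [K, Scheme.IdealSheafData.comap_iSup, monomialSum_ofFn, Scheme.IdealSheafData.comap_iSup]
  exact iSup_congr fun i => h.comap_summand i

/-- The END lists all live on `(𝓒 ++ S.𝓔) ++ S.𝓔`. [folklore] -/
theorem boundaryOf_of_mem_ofFn (h : S.IsFormatSncOn U 𝓒 𝓗) {L : List (X.IdealSheafData × ℕ)}
    (hL : L ∈ List.ofFn fun i => 𝓗 i ++ S.exps i) : boundaryOf L = (𝓒 ++ S.𝓔) ++ S.𝓔 := by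
  obtain ⟨i, rfl⟩ := List.mem_ofFn.mp hL
  simp only [boundaryOf_append, h.boundaryOf_eq i, S.boundaryOf_exps i]

/-- The enlarged family `(𝓒 ++ S.𝓔) ++ S.𝓔` (same member set) has simple normal crossings on `U`.
[cite: BierstoneGrigorievMilmanWlodarczyk2011, Def. 3.1.1] -/
theorem hasSNC_append (h : S.IsFormatSncOn U 𝓒 𝓗) : HasSNC (((𝓒 ++ S.𝓔) ++ S.𝓔).map fun F => F.comap U.ι) := by
  refine DepthGraded.Trace.hasSNCWith_of_subset h.hasSNC fun D hD => ?_
  rw [List.map_append, List.mem_append] at hD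
  rcases hD with hD | hD
  · exact hD
  · rw [List.map_append, List.mem_append]
    exact Or.inr hD

/-- **Shrinking the open**: format-snc END on `U` restricts to every open `U' ≤ U`. [cite: BierstoneGrigorievMilmanWlodarczyk2011, Thm. 8.0.5] -/
theorem mono [IsLocallyNoetherian X] (h : S.IsFormatSncOn U 𝓒 𝓗) {U' : X.Opens} (hU' : U' ≤ U) : S.IsFormatSncOn U' 𝓒 𝓗 := by
  have hι : X.homOfLE hU' ≫ U.ι = U'.ι := X.homOfLE_ι hU'
  refine ⟨h.boundaryOf_eq, ?_, fun i => ?_⟩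
  · have h1 := HasSNCWith.comap_of_isOpenImmersion (X.homOfLE hU') h.hasSNC
    rw [Scheme.IdealSheafData.comap_top, List.map_map] at h1
    refine (List.map_congr_left fun F _ => ?_) ▸ h1
    change (F.comap U.ι).comap (X.homOfLE hU') = F.comap U'.ι
    rw [← Scheme.IdealSheafData.comap_comp, hι]
  · rw [← hι, Scheme.IdealSheafData.comap_comp, Scheme.IdealSheafData.comap_comp, h.host_eq i]

end IsFormatSncOn

/-- [OURS · L1 W5.2] **The exponent-FUNCTION form** (res-L1-w52-plan-1 NOTE G11-10 (2′)): host exponents given as functions `c i` on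
the common family are an instance (`𝓗 i := (𝓒 ++ S.𝓔).map fun F => (F, c i F)`). [cite: Kollar2007, (3.111) Step 3] -/
theorem isFormatSncOn_ofFun (S : MultiHostState X) (U : X.Opens) (𝓒 : List X.IdealSheafData)
    (c : Fin S.n → X.IdealSheafData → ℕ) (hsnc : HasSNC ((𝓒 ++ S.𝓔).map fun F => F.comap U.ι))
    (hhost : ∀ i, (S.host i).comap U.ι = (monomialIdeal ((𝓒 ++ S.𝓔).map fun F => (F, c i F))).comap U.ι) :
    S.IsFormatSncOn U 𝓒 fun i => (𝓒 ++ S.𝓔).map fun F => (F, c i F) :=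
  ⟨fun i => by simp [boundaryOf, List.map_map, Function.comp_def], hsnc, hhost⟩

/-! ## §2 E1: format-snc END ⇒ weak END ⇒ T7β-M -/

section E1

variable {S : MultiHostState X} {U : X.Opens} {𝓒 : List X.IdealSheafData} {𝓗 : Fin S.n → List (X.IdealSheafData × ℕ)}

/-- **E1 (res-L1-w52-plan-1 RULING G11-10 (2))**: a state with at least one summand, cosupported in `U` and format-snc END on `U`, is
END on `U` in the weak sense `IsEndOn` (p543632): members `𝓕 := (𝓒 ++ S.𝓔) ++ S.𝓔`, one exponent list `𝓗 i ++ S.exps i` per summand.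
[cite: BierstoneGrigorievMilmanWlodarczyk2011, Def. 3.1.3] [cite: Kollar2007, (3.111) Step 3] -/
theorem isEndOn_of_isFormatSncOn (hn : S.n ≠ 0) (hU : (S.K.support : Set X) ⊆ (U : Set X))
    (h : S.IsFormatSncOn U 𝓒 𝓗) : S.IsEndOn U :=
  ⟨(𝓒 ++ S.𝓔) ++ S.𝓔, List.ofFn fun i => 𝓗 i ++ S.exps i, fun _ hL => h.boundaryOf_of_mem_ofFn hL,
    fun he => hn (List.ofFn_eq_nil_iff.mp he), h.hasSNC_append, hU, h.comap_K⟩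

/-- **E1 + T4**: on a regular Noetherian `X`, a state with at least one summand, cosupported in `U` and format-snc END on `U`, has its
`K` principalized by a sequence of blowings up with regular centres over `cosupp K`, with regular top (`IsEndOn.exists_centreSeq`,
p543632, over T7β-M p541565/p539550). [cite: Kollar2007, (3.111) Step 3] [cite: GortzWedhorn2020, Prop. 13.91 (1)–(2)] -/
theorem IsFormatSncOn.exists_centreSeq [IsNoetherian X] (hX : Scheme.IsRegular X) (hn : S.n ≠ 0)
    (hU : (S.K.support : Set X) ⊆ (U : Set X)) (h : S.IsFormatSncOn U 𝓒 𝓗) :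
    ∃ s : CentreSeq X, s.AllRegular ∧ s.CentresOver (S.K.support : Set X) ∧ Scheme.IsRegular s.top ∧
      IsLocallyPrincipal (S.K.comap s.comp) :=
  (isEndOn_of_isFormatSncOn hn hU h).exists_centreSeq hX

end E1

/-! ## §3 E2: format-snc END is kept by a `step` whose centre meets `U` in a stratum of the END family -/

section E2

variable [IsLocallyNoetherian X] {S : MultiHostState X} {U : X.Opens} {𝓒 : List X.IdealSheafData}
  {𝓗 : Fin S.n → List (X.IdealSheafData × ℕ)} {τ : X' ⟶ X} {W : Closeds X} {η : X} {m : Fin S.n → ℕ}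

omit [IsLocallyNoetherian X] in
/-- If the trace `𝓘_W|_U` of the centre on `U` is a stratum `T.sup id` of the END family restricted to `U`, the END family on `U` has
simple normal crossings WITH it (Kollár Def. 3.25). [cite: Kollar2007, (3.111) Step 3 with Def. 3.25] -/
theorem IsFormatSncOn.hasSNCWith_comap (h : S.IsFormatSncOn U 𝓒 𝓗) (T : Finset ((U : Scheme.{u}).IdealSheafData))
    (hT : ∀ K ∈ T, K ∈ (𝓒 ++ S.𝓔).map fun F => F.comap U.ι) (hWU : (vanishingIdeal W).comap U.ι = T.sup id) :
    HasSNCWith ((𝓒 ++ S.𝓔).map fun F => F.comap U.ι) ((vanishingIdeal W).comap U.ι) := by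
  rw [hWU]
  exact h.hasSNC.hasSNCWith_finsetSup T hT

/-- **E2 (res-L1-w52-plan-1 RULING G11-10 (2)): FORMAT-SNC END IS KEPT BY A STRATUM STEP.**  Let `S` be format-snc END on `U`
(`𝓒`, `𝓗`), and `S.step τ W η m ν` a step (p540590) at the irreducible centre `W` (generic point `η ∈ U`, `𝓔` snc with `𝓘_W`,
`τ` the blowing up of `𝓘_W`) whose trace on `U` is a STRATUM of the END family (`𝓘_W|_U = T.sup id`, `T ⊆ (𝓒 ++ 𝓔)|_U`), with host
orders `m i ≤ weightAt (𝓗 i) η`.  Then the successor is format-snc END on `τ⁻¹ U` with components the strict transforms `𝓒.map st`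
and host lists `(𝓗 i).map (st × id) ++ [(F, weightAt (𝓗 i) η − m i)]`: every host factorisation is TRANSPORTED by the (T1)
irreducible-centre law (p543632 `controlledTransform_monomialSum_of_isGenericPoint`, run on the scheme `U`) and the successor family
`(𝓒 ++ 𝓔).map st ++ [F]` is snc on `τ⁻¹ U` (Kollár Def. 3.25), both read back on `X′` along the flat open immersion `τ⁻¹U ↪ X′`
(Görtz–Wedhorn Prop. 13.91; `Literature/…/BlowupRestrictOpen`).  No unique factorisation is used.
[cite: Kollar2007, (3.111) Steps 1–3 and Def. 3.25] [cite: BierstoneGrigorievMilmanWlodarczyk2011, Lemma 3.2.1, §4 Step 2b]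
[cite: GortzWedhorn2020, Prop. 13.91] -/
theorem IsFormatSncOn.step (h : S.IsFormatSncOn U 𝓒 𝓗) (hsnc : HasSNCWith S.𝓔 (vanishingIdeal W))
    (hτ : IsBlowup τ (vanishingIdeal W)) (hη : IsGenericPoint η (W : Set X)) (hηU : η ∈ U) (ν : ℕ)
    (T : Finset ((U : Scheme.{u}).IdealSheafData)) (hT : ∀ K ∈ T, K ∈ (𝓒 ++ S.𝓔).map fun F => F.comap U.ι)
    (hWU : (vanishingIdeal W).comap U.ι = T.sup id) (hm : ∀ i, m i ≤ weightAt (𝓗 i) η) :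
    (S.step τ W η m ν hsnc hτ).IsFormatSncOn (τ ⁻¹ᵁ U) (𝓒.map (strictTransformIdeal τ (vanishingIdeal W)))
      fun i => ((𝓗 i).map fun p => (strictTransformIdeal τ (vanishingIdeal W) p.1, p.2)) ++
        [((vanishingIdeal W).comap τ, weightAt (𝓗 i) η - m i)] := by
  haveI : IsProper τ := hτ.isProper
  haveI : IsLocallyNoetherian X' := LocallyOfFiniteType.isLocallyNoetherian τ
  -- the data on the scheme `U`
  have hWv : (vanishingIdeal W).comap U.ι = vanishingIdeal (W.preimage U.ι.continuous) :=
    comap_vanishingIdeal_of_isOpenImmersion U.ι W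
  have hsncU : HasSNCWith ((𝓒 ++ S.𝓔).map fun F => F.comap U.ι) ((vanishingIdeal W).comap U.ι) :=
    h.hasSNCWith_comap T hT hWU
  have hτU : IsBlowup (τ ∣_ U) ((vanishingIdeal W).comap U.ι) := IsBlowup.morphismRestrict τ U hτ
  refine ⟨fun i => ?_, ?_, fun i => ?_⟩
  · rw [DepthTargets.boundaryOf_map_strictTransform_append, h.boundaryOf_eq i, step_𝓔, List.map_append, List.append_assoc]
  · -- the successor family is snc on `τ⁻¹ U`
    have h1 := hsncU.hasSNC_transform hτU
    rw [transformBoundary_morphismRestrict] at h1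
    rw [step_𝓔, ← List.append_assoc, ← List.map_append]
    exact h1
  · -- the host factorisation is transported
    rw [step_host, ← controlledTransform_morphismRestrict, h.host_eq i, DepthTargets.comap_monomialIdeal_eq_map]
    -- the (T1) law on `U` for the single list `(𝓗 i)|_U`
    have hηU' := isGenericPoint_preimage_ι hη U ⟨η, hηU⟩ rfl
    have hb : ∀ L ∈ [(𝓗 i).map fun p => (p.1.comap U.ι, p.2)],
        boundaryOf L = (𝓒 ++ S.𝓔).map fun F => F.comap U.ι := by
      intro L hL
      rw [List.mem_singleton.mp hL, DepthTargets.boundaryOf_map_comap, h.boundaryOf_eq i]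
    have hw : ∀ L ∈ [(𝓗 i).map fun p => (p.1.comap U.ι, p.2)], m i ≤ weightAt L (⟨η, hηU⟩ : U) := by
      intro L hL
      rw [List.mem_singleton.mp hL, weightAt_map_comap]
      exact hm i
    have hlaw := controlledTransform_monomialSum_of_isGenericPoint (τ := τ ∣_ U) (ν := m i) hηU' hb (hWv ▸ hsncU) (hWv ▸ hτU) hw
    rw [List.map_singleton, DepthTargets.monomialSum_singleton, DepthTargets.monomialSum_singleton, ← hWv] at hlaw
    -- read back on `X′`
    have hl : ((𝓗 i).map fun p => (p.1.comap U.ι, p.2)).map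
          (fun p => (strictTransformIdeal (τ ∣_ U) ((vanishingIdeal W).comap U.ι) p.1, p.2)) =
        ((𝓗 i).map fun p => (strictTransformIdeal τ (vanishingIdeal W) p.1, p.2)).map
          fun p => (p.1.comap (τ ⁻¹ᵁ U).ι, p.2) := by
      rw [List.map_map, List.map_map]
      refine List.map_congr_left fun p _ => ?_
      simp only [Function.comp_apply, strictTransformIdeal_morphismRestrict]
    rw [hlaw, weightAt_map_comap, hl, comap_comap_morphismRestrict, DepthTargets.comap_monomialIdeal_eq_map, List.map_append,
      List.map_singleton]
    rfl

end E2

end MultiHostState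

end Summit.ResolutionOfSingularities.ResolutionOfSingularities.Theorems.DepthMultiHost

end
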